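import Summits.Ventures.CertifiedArithmetic.LowPrec.PatternSubnormalBands

/-!
# Remark E5′ below the normal range: the relative column of the subnormal bands

Venture: CertifiedArithmetic (T1-LOWPREC-ENVELOPES). HONEST FRAMING: certified error envelopes and
provably optimal rounding/accumulation schemes for low-precision formats under stated cost models;
every table by two implementations; no hardware or vendor claims.

`PatternSubnormalBands.lean` gives the per-band constants of the subnormal bands in units of the
quantum (the ULP and ABSOLUTE columns of THEOREMS-R1-BANDS, Remark E5′). The RELATIVE column is not
a multiple of those (the magnitude varies inside the band): the relative error of a result of low
pattern `(n, k)` is `errL n k · 2^k / n` (`Format.lowRel`, `errL_mul_quantum_eq`), and the band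
constant is `maxList0` of these weights over the placed patterns — SOUND (`lowRel_le`) and ATTAINED
(`lowRel_attained`) for every rounding with a low bridge and every operation model; named constants
`envconstMulLowRelNE/TZ/Dir`, `envconstAddLowRelNE/TZ/Dir`.
-/

namespace Literature.ComputerArithmetic.FloatingPoint

namespace Format

/-- RELATIVE WEIGHT of a low pattern error: `err · 2^k / n` (the error `err · quantum` relative to
the magnitude `n / 2^k · quantum`). [folklore] -/
def lowRel (errL : ℕ → ℕ → ℚ) (n k : ℕ) : ℚ := errL n k * 2 ^ k / n

/-- `lowRel` of a nonnegative error is nonnegative. [folklore] -/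
theorem lowRel_nonneg {errL : ℕ → ℕ → ℚ} (h : ∀ n k, 0 ≤ errL n k) (n k : ℕ) :
    0 ≤ lowRel errL n k := by
  unfold lowRel
  exact div_nonneg (mul_nonneg (h n k) (by positivity)) (Nat.cast_nonneg _)

end Format

open Format

namespace MiniFloat

variable {X Y : Format}

/-- From quanta to relative: `errL · quantum = lowRel errL · |t|` for `|t| = n / 2^k · quantum ≠ 0`.
[folklore] -/
theorem errL_mul_quantum_eq {R : Format} (errL : ℕ → ℕ → ℚ) {t : ℚ} {n k : ℕ} (ht0 : t ≠ 0)
    (ht : |t| = (n : ℚ) / 2 ^ k * R.quantum) :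
    errL n k * R.quantum = lowRel errL n k * |t| := by
  have hq := R.quantum_pos
  have hn : (n : ℚ) ≠ 0 := by
    intro h0
    rw [h0, zero_div, zero_mul] at ht
    exact ht0 (abs_eq_zero.mp ht)
  rw [ht, lowRel]
  field_simp

/-- SOUNDNESS PER LOW BAND (relative): every result in low band `γ` has error at most
`maxList0 (lowErrsOf (lowRel errL) R γ pats) · |t|`. [folklore] -/
theorem lowRel_le {R : Format} (B : LowBridge R) (M : OpModel X Y R) (γ : ℕ) (a : MiniFloat X)
    (b : MiniFloat Y) (h1 : 2 ^ R.manBits * R.quantum ≤ |M.op a b| * 2 ^ (γ + 1))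
    (h2 : |M.op a b| * 2 ^ (γ + 1) < 2 ^ (R.manBits + 1) * R.quantum) (h3 : |M.op a b| ≤ R.maxRat) :
    |(B.fl (M.op a b)).toRat - M.op a b|
      ≤ maxList0 (lowErrsOf (lowRel B.errL) R γ M.pats) * |M.op a b| := by
  obtain ⟨N, E, hmem, ht⟩ := M.mem_pats a b
  have hB := (lowBandB_iff_of_eq ht).mpr ⟨h1, h2, h3⟩
  have htl := abs_low_of_eq ht
  have hle := B.abs_le _ _ _ (lowN_lt_of_lowBandB hB) htl h3
  rw [errL_mul_quantum_eq B.errL (ne_zero_of_lowBand h1) htl] at hle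
  rw [abs_sub_comm]
  exact le_trans hle (mul_le_mul_of_nonneg_right
    (le_maxList0_of_mem (mem_lowErrsOf.mpr ⟨N, E, hmem, hB, rfl⟩)) (abs_nonneg _))

/-- ATTAINMENT PER LOW BAND (relative). [folklore] -/
theorem lowRel_attained {R : Format} (B : LowBridge R) (M : OpModel X Y R) (γ : ℕ)
    (hne : lowErrsOf (lowRel B.errL) R γ M.pats ≠ []) :
    ∃ (a : MiniFloat X) (b : MiniFloat Y),
      2 ^ R.manBits * R.quantum ≤ |M.op a b| * 2 ^ (γ + 1) ∧
      |M.op a b| * 2 ^ (γ + 1) < 2 ^ (R.manBits + 1) * R.quantum ∧ |M.op a b| ≤ R.maxRat ∧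
      |(B.fl (M.op a b)).toRat - M.op a b|
        = maxList0 (lowErrsOf (lowRel B.errL) R γ M.pats) * |M.op a b| := by
  have hmem := maxList0_mem_of_ne_nil hne (fun c hc => by
    obtain ⟨N, E, -, -, rfl⟩ := mem_lowErrsOf.mp hc
    exact lowRel_nonneg B.errL_nonneg _ _)
  obtain ⟨N, E, hp, hb, hc⟩ := mem_lowErrsOf.mp hmem
  have hN : N ≠ 0 := by
    intro h0
    have h := (lowBandB_eq_true_iff.mp hb).1
    rw [h0, Nat.cast_zero, zero_mul, zero_mul] at h
    exact absurd h (not_le.mpr (by positivity))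
  obtain ⟨a, b, ht, hsgn⟩ := M.realise N E (B.sgn (lowN N E) (lowK E)) hp hN
  have hband := (lowBandB_iff_of_eq ht).mp hb
  have ht0 := ne_zero_of_lowBand hband.1
  have htl := abs_low_of_eq ht
  have heq := B.abs_eq _ _ _ ht0 hsgn (lowN_lt_of_lowBandB hb) htl hband.2.2
  rw [errL_mul_quantum_eq B.errL ht0 htl] at heq
  exact ⟨a, b, hband.1, hband.2.1, hband.2.2, by rw [abs_sub_comm, heq, hc]⟩

end MiniFloat

/-! ### The named low-band relative constants -/

/-- LOW-BAND RELATIVE CONSTANT, products, nearest. [folklore] -/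
def envconstMulLowRelNE (X Y R : Format) (γ : ℕ) : ℚ :=
  maxList0 (lowErrsOf (lowRel lowErrNE) R γ (mulPats X Y R))

/-- LOW-BAND RELATIVE CONSTANT, products, toward zero. [folklore] -/
def envconstMulLowRelTZ (X Y R : Format) (γ : ℕ) : ℚ :=
  maxList0 (lowErrsOf (lowRel lowErrTZ) R γ (mulPats X Y R))

/-- LOW-BAND RELATIVE CONSTANT, products, round down / round up. [folklore] -/
def envconstMulLowRelDir (X Y R : Format) (γ : ℕ) : ℚ :=
  maxList0 (lowErrsOf (lowRel lowErrDir) R γ (mulPats X Y R))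

/-- LOW-BAND RELATIVE CONSTANT, sums, nearest. [folklore] -/
def envconstAddLowRelNE (X Y R : Format) (γ : ℕ) : ℚ :=
  maxList0 (lowErrsOf (lowRel lowErrNE) R γ (addPats X Y R))

/-- LOW-BAND RELATIVE CONSTANT, sums, toward zero. [folklore] -/
def envconstAddLowRelTZ (X Y R : Format) (γ : ℕ) : ℚ :=
  maxList0 (lowErrsOf (lowRel lowErrTZ) R γ (addPats X Y R))

/-- LOW-BAND RELATIVE CONSTANT, sums, round down / round up. [folklore] -/
def envconstAddLowRelDir (X Y R : Format) (γ : ℕ) : ℚ :=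
  maxList0 (lowErrsOf (lowRel lowErrDir) R γ (addPats X Y R))

namespace MiniFloat

variable {X Y : Format}

/-- PRODUCTS, NEAREST, low band `γ`, relative: `|RNE(a·b) − a·b| ≤ envconstMulLowRelNE · |a·b|`.
[folklore] -/
theorem mul_lowRelNE_le (R : Format) (γ : ℕ) (a : MiniFloat X) (b : MiniFloat Y)
    (h1 : 2 ^ R.manBits * R.quantum ≤ |a.toRat * b.toRat| * 2 ^ (γ + 1))
    (h2 : |a.toRat * b.toRat| * 2 ^ (γ + 1) < 2 ^ (R.manBits + 1) * R.quantum)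
    (h3 : |a.toRat * b.toRat| ≤ R.maxRat) :
    |(roundNE R (a.toRat * b.toRat)).toRat - a.toRat * b.toRat|
      ≤ envconstMulLowRelNE X Y R γ * |a.toRat * b.toRat| :=
  lowRel_le (lowBridgeNE R) (mulModel X Y R) γ a b h1 h2 h3

/-- SUMS, ROUND DOWN, low band `γ`, relative: `|RD(a+b) − (a+b)| ≤ envconstAddLowRelDir · |a+b|`.
[folklore] -/
theorem add_lowRelRD_le (R : Format) (γ : ℕ) (a : MiniFloat X) (b : MiniFloat Y)
    (h1 : 2 ^ R.manBits * R.quantum ≤ |a.toRat + b.toRat| * 2 ^ (γ + 1))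
    (h2 : |a.toRat + b.toRat| * 2 ^ (γ + 1) < 2 ^ (R.manBits + 1) * R.quantum)
    (h3 : |a.toRat + b.toRat| ≤ R.maxRat) :
    |(roundDown R (a.toRat + b.toRat)).toRat - (a.toRat + b.toRat)|
      ≤ envconstAddLowRelDir X Y R γ * |a.toRat + b.toRat| :=
  lowRel_le (lowBridgeRD R) (addModel X Y R) γ a b h1 h2 h3

/-- SUMS, ROUND UP, low band `γ`, relative: the constant `envconstAddLowRelDir` is attained.
[folklore] -/
theorem add_lowRelRU_attained (R : Format) (γ : ℕ)
    (hne : lowErrsOf (lowRel lowErrDir) R γ (addPats X Y R) ≠ []) :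
    ∃ (a : MiniFloat X) (b : MiniFloat Y),
      2 ^ R.manBits * R.quantum ≤ |a.toRat + b.toRat| * 2 ^ (γ + 1) ∧
      |a.toRat + b.toRat| * 2 ^ (γ + 1) < 2 ^ (R.manBits + 1) * R.quantum ∧
      |a.toRat + b.toRat| ≤ R.maxRat ∧
      |(roundUp R (a.toRat + b.toRat)).toRat - (a.toRat + b.toRat)|
        = envconstAddLowRelDir X Y R γ * |a.toRat + b.toRat| :=
  lowRel_attained (lowBridgeRU R) (addModel X Y R) γ hne

end MiniFloat

end Literature.ComputerArithmetic.FloatingPoint
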